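import Summits.QuantumFields.YangMills.Theorems.EquipartitionCriticalityFreeEnergyLogCoefficientStubAbstractJointLimit
import HarnessLib

/-!
# Crux `FreeEnergyRate` (stmt-QuantumFields-22402), line `birth`, stub `stub_lowerRate` — the LOWER power rate

Route `EntropyBudgetEquipartition` of `QuantumFields/YangMills` (Chatterjee's two-term free-energy
asymptotics `f_r(β) + (3 dim G/2) log β → K_r` WITH A POWER RATE). HONEST LABEL: a RECORD-label rung
(R2ξ-G); nothing here bears on the Yang–Mills mass gap itself. The LOWER half of the tree's mechanised
proof of Chatterjee's Theorem 2.1 (`freeEnergyLogCoefficient_proof`, item 8759, abstract interface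
`FreeEnergyLogCoefficient.OneBoxBounds`) made QUANTITATIVE: `Gm_ge_of_maxwellRate` (main term under a
Maxwell rate `|log Z_M(B_n)/n^d − L| ≤ C_M n^{−γ}`), `err_le_rpow` (the error majorants `e0`, `errLB`,
`JD` of the regime `n > β³` are `≤ C β^{−b/2}`, `b = 1/(40(d+2))`), `lowerRate_T` (group-free:
`T(B_n, β) ≥ K_∞ − C β^{−min(b/2,γ)}` for `β ≥ β₀`, `n > β³`, `K_∞ = (d−1) log c_H + D L`), and the
REGISTERED STUB `FreeEnergyRate.stub_lowerRate` of the lead's skeleton (Maxwell rate `C/√n`, conclusion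
`∀ᶠ β, ∀ᶠ n, K_∞ − β^{−κ} ≤ T(B_n, β)`); the Maxwell rate itself and the transfer to the torus are
the sibling stub files `…StubMaxwellRate.lean`, `…StubTransfer.lean`.

References: S. Chatterjee, *The leading term of the Yang–Mills free energy*, J. Funct. Anal. 271
(2016), arXiv:1602.01222, §15 (Thm. 15.2), §17 (Lemmas 17.5–17.7). [arXiv160201222]
-/

noncomputable section

open scoped Matrix Matrix.Norms.Frobenius ENNReal NNReal
open MeasureTheory Measure Filter Topology Set
open Literature.Probability.LatticeModels Literature.MathematicalPhysics.QuantumLattice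
open Literature.MathematicalPhysics.QuantumFieldTheory

namespace Summit.QuantumFields.YangMills.Theorems.FreeEnergyLogCoefficient

namespace OneBoxBounds

open ChatterjeeJointLimit WilsonWeakCoupling LatticeMaxwell ChatterjeeAssembly AxialGauge

variable {d : ℕ} (B : OneBoxBounds d)

/-! ### The main term from a Maxwell rate -/

/-- **The main term under a Maxwell rate**: if `|log Z_M(B_n)/n^d − L| ≤ C_M n^{−γ}` for `n ≥ 1`, then
for `1 ≤ β ≤ n`, `G(n) ≥ (d−1) log c_H + D L − (d |log c_H| β^{−1} + D C_M β^{−γ})`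
(`|E_n^1|/n^d = d − 1 − d/n + n^{−d}`, Lemma 17.1). [cite: arXiv160201222, Lemma 17.1] -/
theorem Gm_ge_of_maxwellRate (hd : 1 ≤ d) {L CM γ : ℝ} (hγ : 0 < γ)
    (hM : ∀ n : ℕ, 1 ≤ n → |logZM d n / (n : ℝ) ^ d - L| ≤ CM * (n : ℝ) ^ (-γ))
    {β : ℝ} (hβ : 1 ≤ β) {n : ℕ} (hn : β ≤ n) :
    ((d : ℝ) - 1) * Real.log B.cH + (B.D : ℝ) * L -
        ((d : ℝ) * |Real.log B.cH| * β ^ (-(1 : ℝ)) + (B.D : ℝ) * CM * β ^ (-γ)) ≤ B.Gm n := by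
  have hβ0 : 0 < β := by linarith
  have hn1r : (1 : ℝ) ≤ n := hβ.trans hn
  have hn1 : 1 ≤ n := by exact_mod_cast hn1r
  have hn0 : (0 : ℝ) < n := by linarith
  have hD : (0 : ℝ) ≤ (B.D : ℝ) := Nat.cast_nonneg _
  -- the coefficient
  have hcoef : |coef d n - ((d : ℝ) - 1)| ≤ d * β ^ (-(1 : ℝ)) := by
    rw [coef_eq hd hn1]
    have h1 : (1 : ℝ) / (n : ℝ) ^ d ≤ 1 / n := by
      apply div_le_div_of_nonneg_left zero_le_one hn0
      calc (n : ℝ) = (n : ℝ) ^ 1 := (pow_one _).symm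
        _ ≤ (n : ℝ) ^ d := pow_le_pow_right₀ hn1r hd
    have h2 : (0 : ℝ) ≤ 1 / (n : ℝ) ^ d := by positivity
    have h3 : (1 : ℝ) / n ≤ d / n := by
      apply div_le_div_of_nonneg_right _ hn0.le; exact_mod_cast hd
    have h4 : (d : ℝ) / n ≤ d * β ^ (-(1 : ℝ)) := by
      rw [Real.rpow_neg_one, div_eq_mul_inv]
      exact mul_le_mul_of_nonneg_left ((inv_le_inv₀ hn0 hβ0).2 hn) (Nat.cast_nonneg d)
    rw [abs_le]; constructor <;> linarith
  -- the Maxwell term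
  have hMn := hM n hn1
  have hpow : (n : ℝ) ^ (-γ) ≤ β ^ (-γ) :=
    Real.rpow_le_rpow_of_nonpos hβ0 hn (by linarith)
  have hCM : 0 ≤ CM := by
    have h1 := hM 1 le_rfl
    simp only [Nat.cast_one, Real.one_rpow, mul_one] at h1
    exact (abs_nonneg _).trans h1
  have hM' : -(CM * β ^ (-γ)) ≤ logZM d n / (n : ℝ) ^ d - L := by
    have := (abs_le.1 hMn).1
    nlinarith [mul_le_mul_of_nonneg_left hpow hCM]
  -- combine
  unfold OneBoxBounds.Gm
  have e1 : (coef d n - ((d : ℝ) - 1)) * Real.log B.cH ≥ -(d * β ^ (-(1 : ℝ)) * |Real.log B.cH|) := by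
    have h := abs_mul (coef d n - ((d : ℝ) - 1)) (Real.log B.cH)
    have h2 : |coef d n - ((d : ℝ) - 1)| * |Real.log B.cH| ≤ d * β ^ (-(1 : ℝ)) * |Real.log B.cH| :=
      mul_le_mul_of_nonneg_right hcoef (abs_nonneg _)
    have h3 := neg_abs_le ((coef d n - ((d : ℝ) - 1)) * Real.log B.cH)
    linarith
  have e2 : (B.D : ℝ) * (logZM d n / (n : ℝ) ^ d - L) ≥ -((B.D : ℝ) * CM * β ^ (-γ)) := by
    have := mul_le_mul_of_nonneg_left hM' hD
    linarith
  nlinarith [e1, e2]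

/-! ### The error majorants of the regime `n > β³` are powers of `β` -/

/-- `b = bL d ≤ 1/80`. [folklore] -/
theorem bL_le_eightieth : bL d ≤ 1 / 80 := by
  unfold bL
  rw [div_le_div_iff_of_pos_left one_pos (by positivity) (by norm_num)]
  have : (0 : ℝ) ≤ d := Nat.cast_nonneg d
  linarith

/-- `1 ≤ log β` for `β ≥ 3`. [folklore] -/
theorem one_le_log_of_three_le {β : ℝ} (hβ : 3 ≤ β) : 1 ≤ Real.log β := by
  have h3 : Real.exp 1 < 3 := lt_trans Real.exp_one_lt_d9 (by norm_num)
  have : Real.exp 1 ≤ β := by linarith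
  calc (1 : ℝ) = Real.log (Real.exp 1) := (Real.log_exp 1).symm
    _ ≤ Real.log β := Real.log_le_log (Real.exp_pos 1) this

/-- `B̄(β) ≤ (8d + 4 + log d + 8d² + 2) log β` for `β ≥ 3`. [folklore] -/
theorem Bbar_le_log {β : ℝ} (hβ : 3 ≤ β) :
    Bbar d β ≤ (8 * d + 4 + (Real.log d + 8 * (d : ℝ) ^ 2 + 2)) * Real.log β := by
  unfold Bbar
  have hl1 := one_le_log_of_three_le hβ
  have hl3 : Real.log 3 ≤ Real.log β := Real.log_le_log (by norm_num) hβ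
  have hlogd : 0 ≤ Real.log d := Real.log_natCast_nonneg d
  have hc0 : 0 ≤ Real.log d + 8 * (d : ℝ) ^ 2 + 2 := by positivity
  have hd0 : (0 : ℝ) ≤ 2 * d + 1 := by positivity
  nlinarith [mul_le_mul_of_nonneg_left hl3 hd0, mul_le_mul_of_nonneg_left hl1 hc0]
set_option maxHeartbeats 400000 in
/-- **The error terms of regime D are powers of `β`**: there is `C` with
`e₀(β) + err_LB(β) + J_D(β) ≤ C β^{−b/2}` for all `β ≥ 3` (`b = bL d`). [cite: arXiv160201222, Lemma 17.7 (proof)] -/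
theorem err_le_rpow :
    ∃ C : ℝ, 0 ≤ C ∧ ∀ β : ℝ, 3 ≤ β → B.e0 β + B.errLB β + B.JD β ≤ C * β ^ (-(bL d / 2)) := by
  set b := bL d with hb
  set κ := bL d / 2 with hκ
  have hb0 : 0 < b := bL_pos
  have hκ0 : 0 < κ := by positivity
  have hb80 : b ≤ 1 / 80 := bL_le_eightieth
  have hKκ := B.Kκ_nonneg
  have hA := B.A_nonneg
  have hP := B.P₅_nonneg
  have hKc := B.Kc_nonneg
  have hD : (0 : ℝ) ≤ (B.D : ℝ) := Nat.cast_nonneg _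
  have hdR : (0 : ℝ) ≤ d := Nat.cast_nonneg d
  set CB : ℝ := 8 * d + 4 + (Real.log d + 8 * (d : ℝ) ^ 2 + 2) with hCB
  have hCB0 : 0 ≤ CB := by
    have := Real.log_natCast_nonneg d; rw [hCB]; positivity
  -- the constant
  set C1 : ℝ := B.Kκ * d * B.D + B.A * (d : ℝ) ^ 2 with hC1
  set C2 : ℝ := (B.D : ℝ) * (2 * Real.log 2 + 8 * (d : ℝ) ^ 2 * (CB / κ)) with hC2
  set C3 : ℝ := ((d : ℝ) + 3 * d * 2 ^ (d - 1)) * (B.Kc + d * (B.D : ℝ) / 2) / κ +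
    ((d : ℝ) + 1) * (B.D : ℝ) / κ + 2 ^ d * ((d : ℝ) + 2) * B.P₅ * (d : ℝ) ^ 2 with hC3
  have hlog2 : 0 ≤ Real.log 2 := Real.log_nonneg one_le_two
  have hC10 : 0 ≤ C1 := by rw [hC1]; positivity
  have hC20 : 0 ≤ C2 := by rw [hC2]; positivity
  have hC30 : 0 ≤ C3 := by rw [hC3]; positivity
  refine ⟨C1 + C2 + C3, by positivity, fun β hβ3 => ?_⟩
  have hβ1 : 1 ≤ β := by linarith
  have hβ0 : 0 < β := by linarith
  have hl1 := one_le_log_of_three_le hβ3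
  have hl0 : 0 ≤ Real.log β := by linarith
  have hpκ : 0 < β ^ (-κ) := Real.rpow_pos_of_pos hβ0 _
  have hlogκ : Real.log β ≤ β ^ κ / κ := Real.log_le_rpow_div hβ0.le hκ0
  -- atoms
  have a1 : β ^ (-(2 / 5 : ℝ)) ≤ β ^ (-κ) := Real.rpow_le_rpow_of_exponent_le hβ1 (by linarith)
  have a2 : β ^ (-(1 / 5 : ℝ)) ≤ β ^ (-κ) := Real.rpow_le_rpow_of_exponent_le hβ1 (by linarith)
  have hbpos : 0 < β ^ b := Real.rpow_pos_of_pos hβ0 _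
  have a3 : 1 / β ^ b ≤ β ^ (-κ) := by
    rw [one_div, ← Real.rpow_neg hβ0.le]
    exact Real.rpow_le_rpow_of_exponent_le hβ1 (by linarith)
  have a4 : Real.log β / β ^ b ≤ β ^ (-κ) / κ := by
    calc Real.log β / β ^ b ≤ (β ^ κ / κ) / β ^ b := div_le_div_of_nonneg_right hlogκ hbpos.le
      _ = β ^ (κ - b) / κ := by rw [Real.rpow_sub hβ0]; ring
      _ = β ^ (-κ) / κ := by congr 2; rw [hκ, hb]; ring
  have a7 : 1 / β ≤ β ^ (-κ) := by
    rw [one_div, ← Real.rpow_neg_one]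
    exact Real.rpow_le_rpow_of_exponent_le hβ1 (by linarith)
  have hsq : (1 : ℝ) / β ^ 2 = β ^ (-(2 : ℝ)) := by
    rw [Real.rpow_neg hβ0.le, one_div]; norm_cast
  have a5 : Real.log β / β ^ 2 ≤ β ^ (-κ) / κ := by
    have h1 : Real.log β / β ^ 2 = β ^ (-(2 : ℝ)) * Real.log β := by rw [← hsq]; ring
    rw [h1]
    calc β ^ (-(2 : ℝ)) * Real.log β ≤ β ^ (-(2 : ℝ)) * (β ^ κ / κ) :=
          mul_le_mul_of_nonneg_left hlogκ (Real.rpow_nonneg hβ0.le _)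
      _ = β ^ (-(2 : ℝ) + κ) / κ := by rw [Real.rpow_add hβ0]; ring
      _ ≤ β ^ (-κ) / κ := by
          apply div_le_div_of_nonneg_right _ hκ0.le
          exact Real.rpow_le_rpow_of_exponent_le hβ1 (by linarith)
  have a6 : ((d : ℝ) / β ^ 2 + 3 * d * 2 ^ (d - 1) * (β ^ b / β)) * Real.log β ≤
      ((d : ℝ) + 3 * d * 2 ^ (d - 1)) * (β ^ (-κ) / κ) := by
    have e1 : β ^ b / β = β ^ (b - 1) := (Real.rpow_sub_one hβ0.ne' b).symm
    have e2 : (d : ℝ) / β ^ 2 ≤ d * β ^ (b - 1) := by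
      rw [div_eq_mul_one_div, hsq]
      exact mul_le_mul_of_nonneg_left (Real.rpow_le_rpow_of_exponent_le hβ1 (by linarith)) hdR
    have hf : (d : ℝ) / β ^ 2 + 3 * d * 2 ^ (d - 1) * (β ^ b / β) ≤
        ((d : ℝ) + 3 * d * 2 ^ (d - 1)) * β ^ (b - 1) := by rw [e1]; nlinarith
    have hf0 : 0 ≤ ((d : ℝ) + 3 * d * 2 ^ (d - 1)) := by positivity
    have hp0 : 0 ≤ β ^ (b - 1) := Real.rpow_nonneg hβ0.le _
    calc ((d : ℝ) / β ^ 2 + 3 * d * 2 ^ (d - 1) * (β ^ b / β)) * Real.log β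
        ≤ (((d : ℝ) + 3 * d * 2 ^ (d - 1)) * β ^ (b - 1)) * (β ^ κ / κ) :=
          mul_le_mul hf hlogκ hl0 (by positivity)
      _ = ((d : ℝ) + 3 * d * 2 ^ (d - 1)) * (β ^ (b - 1 + κ) / κ) := by rw [Real.rpow_add hβ0]; ring
      _ ≤ ((d : ℝ) + 3 * d * 2 ^ (d - 1)) * (β ^ (-κ) / κ) := by
          apply mul_le_mul_of_nonneg_left _ hf0
          apply div_le_div_of_nonneg_right _ hκ0.le
          exact Real.rpow_le_rpow_of_exponent_le hβ1 (by rw [hκ, hb] at *; linarith)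
  -- term 1: e0
  have t1 : B.e0 β ≤ C1 * β ^ (-κ) := by
    unfold OneBoxBounds.e0
    have h1 : B.Kκ * d * (B.D : ℝ) * β ^ (-(2 / 5 : ℝ)) ≤ B.Kκ * d * B.D * β ^ (-κ) :=
      mul_le_mul_of_nonneg_left a1 (by positivity)
    have h2 : B.A * (d : ℝ) ^ 2 * β ^ (-(1 / 5 : ℝ)) ≤ B.A * (d : ℝ) ^ 2 * β ^ (-κ) :=
      mul_le_mul_of_nonneg_left a2 (by positivity)
    rw [hC1]; linarith
  -- term 2: errLB
  have t2 : B.errLB β ≤ C2 * β ^ (-κ) := by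
    unfold OneBoxBounds.errLB
    have hBb : Bbar d β ≤ CB * Real.log β := by rw [hCB]; exact Bbar_le_log hβ3
    have h1 : 2 * Real.log 2 / β ^ b ≤ 2 * Real.log 2 * β ^ (-κ) := by
      rw [div_eq_mul_one_div]; exact mul_le_mul_of_nonneg_left a3 (by positivity)
    have h2 : 8 * (d : ℝ) ^ 2 * Bbar d β / β ^ b ≤ 8 * (d : ℝ) ^ 2 * (CB / κ) * β ^ (-κ) := by
      calc 8 * (d : ℝ) ^ 2 * Bbar d β / β ^ b = 8 * (d : ℝ) ^ 2 * (Bbar d β / β ^ b) := by ring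
        _ ≤ 8 * (d : ℝ) ^ 2 * (CB * Real.log β / β ^ b) := by
            apply mul_le_mul_of_nonneg_left _ (by positivity)
            exact div_le_div_of_nonneg_right hBb hbpos.le
        _ = 8 * (d : ℝ) ^ 2 * CB * (Real.log β / β ^ b) := by ring
        _ ≤ 8 * (d : ℝ) ^ 2 * CB * (β ^ (-κ) / κ) := mul_le_mul_of_nonneg_left a4 (by positivity)
        _ = 8 * (d : ℝ) ^ 2 * (CB / κ) * β ^ (-κ) := by ring
    have h3 := add_le_add h1 h2
    have := mul_le_mul_of_nonneg_left h3 hD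
    rw [hC2]; linarith
  -- term 3: JD
  have t3 : B.JD β ≤ C3 * β ^ (-κ) := by
    unfold OneBoxBounds.JD
    have hK0 : 0 ≤ B.Kc + d * (B.D : ℝ) / 2 := by positivity
    have h1 : ((d : ℝ) / β ^ 2 + 3 * d * 2 ^ (d - 1) * (β ^ b / β)) * (B.Kc + d * (B.D : ℝ) / 2) * Real.log β
        ≤ ((d : ℝ) + 3 * d * 2 ^ (d - 1)) * (B.Kc + d * (B.D : ℝ) / 2) / κ * β ^ (-κ) := by
      have := mul_le_mul_of_nonneg_left a6 hK0
      calc ((d : ℝ) / β ^ 2 + 3 * d * 2 ^ (d - 1) * (β ^ b / β)) * (B.Kc + d * (B.D : ℝ) / 2) * Real.log β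
          = (B.Kc + d * (B.D : ℝ) / 2) *
              (((d : ℝ) / β ^ 2 + 3 * d * 2 ^ (d - 1) * (β ^ b / β)) * Real.log β) := by ring
        _ ≤ (B.Kc + d * (B.D : ℝ) / 2) * (((d : ℝ) + 3 * d * 2 ^ (d - 1)) * (β ^ (-κ) / κ)) := this
        _ = _ := by ring
    have h2 : ((d : ℝ) + 1) * (B.D : ℝ) * (Real.log β / β ^ 2) ≤ ((d : ℝ) + 1) * (B.D : ℝ) / κ * β ^ (-κ) := by
      have := mul_le_mul_of_nonneg_left a5 (by positivity : 0 ≤ ((d : ℝ) + 1) * (B.D : ℝ))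
      calc ((d : ℝ) + 1) * (B.D : ℝ) * (Real.log β / β ^ 2) ≤ ((d : ℝ) + 1) * (B.D : ℝ) * (β ^ (-κ) / κ) := this
        _ = _ := by ring
    have h3 : 2 ^ d * ((d : ℝ) + 2) * B.P₅ * (d : ℝ) ^ 2 / β ≤ 2 ^ d * ((d : ℝ) + 2) * B.P₅ * (d : ℝ) ^ 2 * β ^ (-κ) := by
      rw [div_eq_mul_one_div]
      exact mul_le_mul_of_nonneg_left a7 (by positivity)
    rw [hC3]
    have e : (((d : ℝ) + 3 * d * 2 ^ (d - 1)) * (B.Kc + d * (B.D : ℝ) / 2) / κ +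
        ((d : ℝ) + 1) * (B.D : ℝ) / κ + 2 ^ d * ((d : ℝ) + 2) * B.P₅ * (d : ℝ) ^ 2) * β ^ (-κ) =
        ((d : ℝ) + 3 * d * 2 ^ (d - 1)) * (B.Kc + d * (B.D : ℝ) / 2) / κ * β ^ (-κ) +
        ((d : ℝ) + 1) * (B.D : ℝ) / κ * β ^ (-κ) + 2 ^ d * ((d : ℝ) + 2) * B.P₅ * (d : ℝ) ^ 2 * β ^ (-κ) := by ring
    rw [e]; linarith
  have e : (C1 + C2 + C3) * β ^ (-κ) = C1 * β ^ (-κ) + C2 * β ^ (-κ) + C3 * β ^ (-κ) := by ring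
  rw [e]; linarith

/-! ### The thresholds of regime D hold for large `β` -/

/-- The side conditions of `OneBoxBounds.lowD` hold for all large `β`. [folklore] -/
theorem eventually_lowD_hyps (hd : 1 ≤ d) :
    ∃ β₁ : ℝ, ∀ β : ℝ, β₁ ≤ β → 3 ≤ β ∧ β ^ (-(2 / 5 : ℝ)) ≤ B.r₁ ∧ B.ν ≤ β ^ (1 / 10 : ℝ) ∧
      Rbfun d (bL d) β / β ^ (1 / 10 : ℝ) ≤ 1 / B.ν ∧ 4 ≤ β ^ bL d ∧ 4 ≤ β ^ (1 - bL d) := by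
  have hN0 : (0 : ℝ) < B.ν := lt_of_lt_of_le one_pos B.one_le_ν
  have hr₁ := B.r₁_pos
  have hev : ∀ᶠ β : ℝ in atTop, 3 ≤ β ∧ β ^ (-(2 / 5 : ℝ)) ≤ B.r₁ ∧ B.ν ≤ β ^ (1 / 10 : ℝ) ∧
      Rbfun d (bL d) β / β ^ (1 / 10 : ℝ) ≤ 1 / B.ν ∧ 4 ≤ β ^ bL d ∧ 4 ≤ β ^ (1 - bL d) := by
    refine (eventually_ge_atTop 3).and (Eventually.and ?_ (Eventually.and ?_ (Eventually.and ?_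
      (Eventually.and ?_ ?_))))
    · exact (tendsto_rpow_neg_atTop (by norm_num : (0 : ℝ) < 2 / 5)).eventually (ge_mem_nhds hr₁)
    · exact (tendsto_rpow_atTop (by norm_num : (0 : ℝ) < 1 / 10)).eventually_ge_atTop _
    · exact (tendsto_Rbfun_div (d := d) hd bL_pos.le bL_mul_lt).eventually
        (ge_mem_nhds (by positivity))
    · exact (tendsto_rpow_atTop (bL_pos (d := d))).eventually_ge_atTop _
    · exact (tendsto_rpow_atTop (by linarith [bL_lt_one (d := d)] : (0 : ℝ) < 1 - bL d)).eventually_ge_atTop _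
  obtain ⟨β₁, hβ₁⟩ := eventually_atTop.1 hev
  exact ⟨β₁, hβ₁⟩

/-! ### The abstract lower power rate -/

/-- **The lower power rate, group-free** (Chatterjee's regime `n > β³` of Lemma 17.7 made
quantitative): given a Maxwell rate `|log Z_M(B_n)/n^d − L| ≤ C_M n^{−γ}` (`n ≥ 1`, `γ > 0`), there are
`C, β₀` with `T(B_n, β) ≥ (d−1) log c_H + D L − C β^{−min(b/2, γ)}` for all `β ≥ β₀` and all
`n > β³` (`b = 1/(40(d+2))`). [cite: arXiv160201222, Lemma 17.7] -/
theorem lowerRate_T (hd : 2 ≤ d) {L CM γ : ℝ} (hγ : 0 < γ)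
    (hM : ∀ n : ℕ, 1 ≤ n → |logZM d n / (n : ℝ) ^ d - L| ≤ CM * (n : ℝ) ^ (-γ)) :
    ∃ C β₀ : ℝ, 0 ≤ C ∧ ∀ β : ℝ, β₀ ≤ β → ∀ n : ℕ, β ^ 3 < (n : ℝ) →
      ((d : ℝ) - 1) * Real.log B.cH + (B.D : ℝ) * L - C * β ^ (-(min (bL d / 2) γ)) ≤ B.T n β := by
  have hd1 : 1 ≤ d := by omega
  obtain ⟨Ce, hCe0, hCe⟩ := B.err_le_rpow
  obtain ⟨β₁, hβ₁⟩ := B.eventually_lowD_hyps hd1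
  have hCM : 0 ≤ CM := by
    have h1 := hM 1 le_rfl
    simp only [Nat.cast_one, Real.one_rpow, mul_one] at h1
    exact (abs_nonneg _).trans h1
  have hD : (0 : ℝ) ≤ (B.D : ℝ) := Nat.cast_nonneg _
  set κ := min (bL d / 2) γ with hκ
  have hb0 : 0 < bL d := bL_pos
  have hb80 : bL d ≤ 1 / 80 := bL_le_eightieth
  refine ⟨Ce + ((d : ℝ) * |Real.log B.cH| + (B.D : ℝ) * CM), β₁, by positivity, fun β hβ n hn => ?_⟩
  obtain ⟨hβ3, c2, c4, c6, c7, c11⟩ := hβ₁ β hβ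
  have hβ2 : 2 ≤ β := by linarith
  have hβ1 : 1 ≤ β := by linarith
  have hβ0 : 0 < β := by linarith
  -- regime D
  have hG : ∀ n' : ℕ, β ≤ n' → ((d : ℝ) - 1) * Real.log B.cH + (B.D : ℝ) * L -
      ((d : ℝ) * |Real.log B.cH| * β ^ (-(1 : ℝ)) + (B.D : ℝ) * CM * β ^ (-γ)) ≤ B.Gm n' :=
    fun n' hn' => B.Gm_ge_of_maxwellRate hd1 hγ hM hβ1 hn'
  have hlow := B.lowD hd1 hβ2 c2 c4 c6 c7 c11 hn hG
  have herr := hCe β hβ3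
  -- compare the exponents with `κ`
  have p1 : β ^ (-(1 : ℝ)) ≤ β ^ (-κ) :=
    Real.rpow_le_rpow_of_exponent_le hβ1 (by have := min_le_left (bL d / 2) γ; linarith)
  have p2 : β ^ (-γ) ≤ β ^ (-κ) :=
    Real.rpow_le_rpow_of_exponent_le hβ1 (by have := min_le_right (bL d / 2) γ; linarith)
  have p3 : β ^ (-(bL d / 2)) ≤ β ^ (-κ) :=
    Real.rpow_le_rpow_of_exponent_le hβ1 (by have := min_le_left (bL d / 2) γ; linarith)
  have q1 := mul_le_mul_of_nonneg_left p1 (by positivity : 0 ≤ (d : ℝ) * |Real.log B.cH|)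
  have q2 := mul_le_mul_of_nonneg_left p2 (by positivity : 0 ≤ (B.D : ℝ) * CM)
  have q3 := mul_le_mul_of_nonneg_left p3 hCe0
  have e : (Ce + ((d : ℝ) * |Real.log B.cH| + (B.D : ℝ) * CM)) * β ^ (-κ) =
      Ce * β ^ (-κ) + ((d : ℝ) * |Real.log B.cH| * β ^ (-κ) + (B.D : ℝ) * CM * β ^ (-κ)) := by ring
  rw [e]
  linarith

end OneBoxBounds

end Summit.QuantumFields.YangMills.Theorems.FreeEnergyLogCoefficient

/-! ### The registered stub -/

namespace Summit.QuantumFields.YangMills.Theorems.FreeEnergyRate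

open Summit.QuantumFields.YangMills.Theorems.FreeEnergyLogCoefficient ChatterjeeJointLimit ChatterjeeAssembly

/-- **STUB `stub_lowerRate` of line `birth` (crux `FreeEnergyRate`, stmt-QuantumFields-22402) — the
lower power rate, group-free.** For an abstract one-box interface `B : OneBoxBounds d` (`d ≥ 2`) and a
Maxwell rate `|log Z_M(B_n)/n^d − L| ≤ C/√n` (`n ≥ 1`), there is `κ > 0` such that, for all large `β`
and then all large `n`, `T(B_n, β) ≥ (d−1) log c_H + D L − β^{−κ}` (Chatterjee's regime `n > β³` of
Lemma 17.7 made quantitative: `OneBoxBounds.lowerRate_T` with `γ = 1/2`, the constant absorbed into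
half the exponent). [cite: arXiv160201222, Lemma 17.7] -/
theorem stub_lowerRate {d : ℕ} (hd : 2 ≤ d) (B : OneBoxBounds d) {L C : ℝ}
    (hL : ∀ n : ℕ, 1 ≤ n → |ChatterjeeAssembly.logZM d n / (n : ℝ) ^ d - L| ≤ C / Real.sqrt n) :
    ∃ κ : ℝ, 0 < κ ∧ ∀ᶠ β : ℝ in atTop, ∀ᶠ n : ℕ in atTop,
      ((d : ℝ) - 1) * Real.log B.cH + (B.D : ℝ) * L - β ^ (-κ) ≤ B.T n β := by
  -- the Maxwell rate in power form, `γ = 1/2`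
  have hM : ∀ n : ℕ, 1 ≤ n → |logZM d n / (n : ℝ) ^ d - L| ≤ C * (n : ℝ) ^ (-(1 / 2 : ℝ)) := by
    intro n hn
    have h := hL n hn
    have hn0 : (0 : ℝ) ≤ n := Nat.cast_nonneg n
    have e : C / Real.sqrt n = C * (n : ℝ) ^ (-(1 / 2 : ℝ)) := by
      rw [Real.sqrt_eq_rpow, Real.rpow_neg hn0, div_eq_mul_inv]
    rwa [e] at h
  obtain ⟨C', β₀, hC'0, hrate⟩ := B.lowerRate_T hd (by norm_num : (0 : ℝ) < 1 / 2) hM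
  set κ₀ : ℝ := min (bL d / 2) (1 / 2) with hκ₀
  have hκ₀0 : 0 < κ₀ := lt_min (by have := bL_pos (d := d); positivity) (by norm_num)
  refine ⟨κ₀ / 2, by positivity, ?_⟩
  have hev : ∀ᶠ β : ℝ in atTop, β₀ ≤ β ∧ 1 ≤ β ∧ C' ≤ β ^ (κ₀ / 2) :=
    (eventually_ge_atTop β₀).and ((eventually_ge_atTop 1).and
      ((tendsto_rpow_atTop (by positivity : 0 < κ₀ / 2)).eventually_ge_atTop C'))
  filter_upwards [hev] with β ⟨hβ, hβ1, hC'⟩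
  have hβ0 : 0 < β := by linarith
  -- `C' β^{-κ₀} ≤ β^{-κ₀/2}`
  have hab : C' * β ^ (-κ₀) ≤ β ^ (-(κ₀ / 2)) := by
    have hp : 0 ≤ β ^ (-κ₀) := Real.rpow_nonneg hβ0.le _
    calc C' * β ^ (-κ₀) ≤ β ^ (κ₀ / 2) * β ^ (-κ₀) := mul_le_mul_of_nonneg_right hC' hp
      _ = β ^ (-(κ₀ / 2)) := by rw [← Real.rpow_add hβ0]; congr 1; ring
  filter_upwards [eventually_gt_atTop ⌈β ^ 3⌉₊] with n hn
  have hn' : β ^ 3 < (n : ℝ) := lt_of_le_of_lt (Nat.le_ceil _) (by exact_mod_cast hn)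
  have h := hrate β hβ n hn'
  linarith

end Summit.QuantumFields.YangMills.Theorems.FreeEnergyRate

end
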